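import Summits.CriticalPhenomena.SAWScalingLimit.Theses.SAWDevelopingMap
import Summits.CriticalPhenomena.SAWScalingLimit.Theses.SAWPhaseRetrieval
import Summits.CriticalPhenomena.SAWScalingLimit.Theses.SAWWindingAlias
import Summits.CriticalPhenomena.SAWScalingLimit.Theses.SAWDefectDecoherence
import Summits.CriticalPhenomena.SAWScalingLimit.Theses.SAWCompassLattice
import Summits.CriticalPhenomena.SAWScalingLimit.Theses.SAWResidueField
import Summits.CriticalPhenomena.SAWScalingLimit.Theorems.SAWDevelopingMapHexTransferPinLineReduction

/-!
# Line `pin-the-shear` for the crux `HexTransfer` (stmt-CriticalPhenomena-14221) — skeleton, revision 3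
(line lead prover-line-stmt-CriticalPhenomena-14221-c2-0, third seat, 2026-08-16)

Crux: `HexTransfer := (Duminil-Copin–Smirnov 2012 Conjecture 1 on the hexagonal lattice, written out;
"(A)") → SAWScalingLimit` (`Theses.SAWPhaseRetrieval.HexTransfer`; identical bodies in `SAWDevelopingMap`,
`SAWWindingAlias`, `SAWDefectDecoherence`). Idea card `Cruxes/HexTransfer/Ideas/pin-the-shear.md`;
planner skeleton `Lines/pin_the_shear.lean` (7 stubs), driven by leads -1 / c1 (cycles 1–2) to the state
recorded here.

## The line and what is left of it

Every lattice comparison is asked only MODULO ONE UNIDENTIFIED LINEAR MAP `Φ ∈ GL₂⁺(ℝ)`, pinned a posteriori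
by (A), the exact quarter-turn symmetry of `δℤ²` and stretch rigidity of the chordal SLE(8/3) family.
Five of the seven registered stubs are THEOREMS OF THE TREE and are imported, not restated:
`stub_quarterTurnCovariance` (item 5794, p96607), `stub_stretchRigidity` (item 5793, p100783, over the
flat-point restriction sub-stubs 4a–4d p98133 p98621 p98249 p97793 and p98316), `stub_linearPinning`
(p96403), `stub_conjugateRotationCovariance` (p96518), `stub_similarityIdentification` (p96344); and the
COMPOSITION through them is landed as `stub_pinLineReduction` (p103231,
`Theorems/SAWDevelopingMapHexTransferPinLineReduction.lean`):
`(YB shear transport) → SurfaceUniversality → HexTransfer`.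

So the skeleton is down to its two open stubs, both of open-problem size:
* `stub_ybShearTransport` — law-level Yang–Baxter transport hexagonal ↦ GM `Θ ≡ π/2`, modulo `Φ`, under (A)
  (implied, with `Φ = id`, by item stmt-6967 `YBSquareSLE`: c1's `ybShearTransport_of_ybSquareSLE`,
  `Lines/pin_the_shear_c1_reduction.lean`);
* `stub_surfaceUniversality` — item stmt-CriticalPhenomena-6964 verbatim.

Independently of the line, the crux is pinned to the existing item stmt-0807 (this seat,
`Theorems/SAWPhaseRetrievalHexTransferOfLatticeUniversality.lean`): `LatticeUniversality → HexTransfer`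
unconditionally and `HexTransfer ↔ (HexSAWScalingLimit → LatticeUniversality)`.

Disproof used: `Cruxes/HexTransfer/Disproof.lean` (cdisprove cycle 1; `Negative/RefutationCost.lean` p95732):
§2 no `_false_without_` theorem exists for this one-hypothesis crux; §4 rigidity respected (the line factors
universality through GM(π/2), it does not undercut it); §6 no stub false or misstated; the finite-volume
strengthening of the transport IS false (slit check), which is why stub 1 is asymptotic and modulo `Φ`.
-/

noncomputable section

namespace Summit.CriticalPhenomena.SAWScalingLimit.Cruxes.HexTransfer.PinTheShear

open MeasureTheory Filter Topology Set
open scoped NNReal ENNReal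
open Literature.Probability.RandomPlanarGeometry
open Literature.Probability.RandomPlanarGeometry.SAW.YangBaxter
open Literature.Probability.LatticeModels (Site HexVertex hexGraph hexCenter)
open Summit.CriticalPhenomena.SAWScalingLimit.Theses

/-! ### Stub 1 — the Yang–Baxter transport modulo an unidentified shear (hardest, open; held by the lead) -/

/-- Stub (lead; open-problem sized). **YB shear transport.** Under Duminil-Copin–Smirnov's Conjecture 1
(the crux's hypothesis (A), `HexConjecture`), there is ONE linear map `Φ` of positive determinant such
that, for every Dobrushin domain `D` and every mid-edge endpoint approximation of `D` on the square tiling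
`Θ ≡ π/2`, some hexagonal endpoint approximation of `Φ⁻¹(D)` makes the critical Glazman–Manolescu law in
`D` and the `Φ`-image of the critical hexagonal SAW law in `Φ⁻¹(D)` asymptotically equal on bounded
continuous test functions. Conjecturally `Φ = id` works (then it is item stmt-6967 under (A)). -/
theorem stub_ybShearTransport :
    SAWDevelopingMap.HexConjecture →
    ∃ m₁₁ m₁₂ m₂₁ m₂₂ : ℝ, 0 < m₁₁ * m₂₂ - m₁₂ * m₂₁ ∧ ∀ Φ : ℂ ≃ₜ ℂ,
      (∀ z : ℂ, Φ z = ((m₁₁ * z.re + m₁₂ * z.im : ℝ) : ℂ) +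
          ((m₂₁ * z.re + m₂₂ * z.im : ℝ) : ℂ) * Complex.I) →
      ∀ (D : DobrushinDomain) (a b : ℝ → MidEdge),
        IsYBEndpointApprox (fun (_ : ℤ) => Real.pi / 2) D a b →
        ∃ a' b' : ℝ → HexVertex,
          SAW.IsEmbEndpointApprox hexGraph hexCenter (D.map Φ.symm) a' b' ∧
          ∀ f : BoundedContinuousFunction (CurveClass ℂ) ℝ,
            Tendsto (fun δ => (∫ γ, f (γ.curve (fun (_ : ℤ) => Real.pi / 2) δ)
                ∂(ybLaw (fun (_ : ℤ) => Real.pi / 2) D.carrier δ 1 (a δ) (b δ))) -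
              ∫ γ, f (CurveClass.map (Φ : C(ℂ, ℂ)) γ.curve)
                ∂(SAW.hexSAWLaw (D.map Φ.symm).carrier δ (a' δ) (b' δ)))
              (𝓝[>] 0) (𝓝 0) := by
  sorry

/-! ### Stub 2 — surface universality (item stmt-CriticalPhenomena-6964 verbatim) -/

/-- Stub (= item stmt-CriticalPhenomena-6964, open-problem sized). **Surface universality**: the compass
chordal law and the critical uniform `δℤ²` SAW law are asymptotically equal on bounded continuous test
functions (D4-internal universality on one port scaffold). -/
theorem stub_surfaceUniversality : SAWCompassLattice.SurfaceUniversality := by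
  sorry

/-! ### The line closes the crux modulo its two open stubs (composition landed, p103231) -/

/-- **The crux from the line's stubs**: the landed reduction `stub_pinLineReduction` (transport chain
`imageLimit_of_transport` + conjugate-rotation covariance + linear pinning over stretch rigidity + the
2×2 pin + similarity identification, all theorems of the tree) applied to the two open stubs. -/
theorem HexTransfer_of : SAWPhaseRetrieval.HexTransfer :=
  stub_pinLineReduction stub_ybShearTransport stub_surfaceUniversality

/-- The same term closes route `SAWDevelopingMap`'s copy of the crux (identical body). -/
theorem HexTransfer_developingMap : SAWDevelopingMap.HexTransfer := HexTransfer_of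

/-- The same term closes route `SAWWindingAlias`'s copy of the crux (identical body). -/
theorem HexTransfer_windingAlias : SAWWindingAlias.HexTransfer := HexTransfer_of

/-- The same term closes route `SAWDefectDecoherence`'s copy of the crux (identical body). -/
theorem HexTransfer_defectDecoherence : SAWDefectDecoherence.HexTransfer := HexTransfer_of

end Summit.CriticalPhenomena.SAWScalingLimit.Cruxes.HexTransfer.PinTheShear

end
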